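import Mathlib
import Summits.ValiantsHypothesis.ValiantsHypothesis.Theorems.NewtonUnitEquationsDissociatedUniformTotalsLaw
import Summits.ValiantsHypothesis.ValiantsHypothesis.Theorems.NewtonUnitEquationsDissociatedUniformTotalsLawChartTops
import Summits.ValiantsHypothesis.ValiantsHypothesis.Theorems.NewtonUnitEquationsDissociatedUniformTotalsLawSweep
import Summits.ValiantsHypothesis.ValiantsHypothesis.Theorems.NewtonUnitEquationsDissociatedUniformTotalsLawHeavyPairs
import Summits.ValiantsHypothesis.ValiantsHypothesis.Theorems.NewtonUnitEquationsDissociatedUniformTotalsLawTriangleWords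
import Literature.Computability.AlgebraicComplexity.NewtonPolygonTauProductBounds
import HarnessLib

/-!
# Crux `NewtonUnitEquations.DissociatedUniform` (stmt-ValiantsHypothesis-5905), `n = 3` totals law of model (Q**):
# CHART SAMPLES — the tie-broken top letters of the pair fibres form interval systems, and class chart tops are triangle words

Geometric layer of the sub-cubic bound (companions `…TotalsLawHeavyPairs`, `…TotalsLawTriangleWords`; assembly in
`…TotalsLawSubCubic`).  Fix curves `a b c : G → ℝ²` and a half-chart `σ = ±1` of weights `(σ, t)` (KPTT `IsStrictTop` calculus).
* `topLetter w φ` — the TIE-BROKEN top letter of a letter-indexed point family `φ : G → ℝ²` for the weight `w`: among the letters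
  maximising `⟨w, φ ·⟩`, the one of least code (`enc`, a fixed enumeration of `G`).  No injectivity of the curves is needed anywhere:
  coincident points are handled by the tie-break (`topLetter_eq_of_isStrictTop`).
* GENERIC TIMES (`tieSet`): `t` is generic if `(σ, t)` separates all pair sums of the three systems; then every fibre has a strict
  top POINT and `topLetter` names it (`isStrictTop_topLetter`).  Every chart top of a class is exposed at a generic time
  (`exists_generic_exposing`), and we choose one (`texp`); the SAMPLE SET `samples` collects these choices (plus one generic
  dummy), sorted increasingly as `τ 0 ≤ τ 1 ≤ … ≤ τ N` (`tau`, via `Finset.orderEmbOfFin`).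
* `isIntervalSys_TP/TQ/TR` — along the sorted samples the top letters of the `P`-, `Q`-, `R`-fibres
  (`TPs i r = topLetter (σ, τ i) (x ↦ a x + b (r - x))` etc.) are INTERVAL SYSTEMS (`IsStrictTop.of_between` + the time-independent
  tie-break).
The injection of class chart tops into triangle words is the companion `…TotalsLawChartTriangles`.
[folklore]
-/

set_option linter.dupNamespace false -- `ValiantsHypothesis.ValiantsHypothesis` (summit = problem) in every name

open Finset Matrix

namespace Summit.ValiantsHypothesis.ValiantsHypothesis.Theorems.NewtonUnitEquationsDissociatedUniform

namespace TotalsLaw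

open Literature.Computability.AlgebraicComplexity.KPTT.PlanarMinkowski

variable {G : Type*} [AddCommGroup G] [Fintype G] [DecidableEq G]

/-! ### The tie-broken top letter -/

/-- A fixed enumeration of the label group (for tie-breaking). -/
noncomputable def enc : G → ℕ := fun g => (Fintype.equivFin G g : ℕ)

omit [AddCommGroup G] [DecidableEq G] in
/-- `enc` is injective. [folklore] -/
theorem enc_injective : Function.Injective (enc : G → ℕ) := fun _ _ e =>
  (Fintype.equivFin G).injective (Fin.ext e)

omit [AddCommGroup G] [DecidableEq G] in
/-- There is a letter maximising `⟨w, φ ·⟩` of least code among the maximisers. [folklore] -/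
theorem exists_topLetter [Nonempty G] (w : Fin 2 → ℝ) (φ : G → (Fin 2 → ℝ)) :
    ∃ ℓ : G, (∀ ℓ', w ⬝ᵥ φ ℓ' ≤ w ⬝ᵥ φ ℓ) ∧ ∀ ℓ', (∀ ℓ'', w ⬝ᵥ φ ℓ'' ≤ w ⬝ᵥ φ ℓ') → enc ℓ ≤ enc ℓ' := by
  classical
  obtain ⟨ℓ₀, -, hmax⟩ := exists_max_image univ (fun ℓ => w ⬝ᵥ φ ℓ) univ_nonempty
  set M := univ.filter fun ℓ : G => ∀ ℓ', w ⬝ᵥ φ ℓ' ≤ w ⬝ᵥ φ ℓ with hM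
  have hMne : M.Nonempty := ⟨ℓ₀, mem_filter.2 ⟨mem_univ _, fun ℓ' => hmax ℓ' (mem_univ _)⟩⟩
  obtain ⟨ℓ₁, hℓ₁, hmin⟩ := exists_min_image M enc hMne
  exact ⟨ℓ₁, (mem_filter.1 hℓ₁).2, fun ℓ' hℓ' => hmin ℓ' (mem_filter.2 ⟨mem_univ _, hℓ'⟩)⟩

open Classical in
/-- The TIE-BROKEN TOP LETTER of the family `φ` for the weight `w`: the maximiser of `⟨w, φ ·⟩` of least code. -/
noncomputable def topLetter (w : Fin 2 → ℝ) (φ : G → (Fin 2 → ℝ)) : G :=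
  if h : ∃ ℓ : G, (∀ ℓ', w ⬝ᵥ φ ℓ' ≤ w ⬝ᵥ φ ℓ) ∧ ∀ ℓ', (∀ ℓ'', w ⬝ᵥ φ ℓ'' ≤ w ⬝ᵥ φ ℓ') → enc ℓ ≤ enc ℓ'
  then Classical.choose h else 0

omit [DecidableEq G] in
/-- Defining property of `topLetter`. [folklore] -/
theorem topLetter_spec (w : Fin 2 → ℝ) (φ : G → (Fin 2 → ℝ)) :
    (∀ ℓ', w ⬝ᵥ φ ℓ' ≤ w ⬝ᵥ φ (topLetter w φ)) ∧
      ∀ ℓ', (∀ ℓ'', w ⬝ᵥ φ ℓ'' ≤ w ⬝ᵥ φ ℓ') → enc (topLetter w φ) ≤ enc ℓ' := by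
  classical
  have h := exists_topLetter w φ
  unfold topLetter
  rw [dif_pos h]
  exact Classical.choose_spec h

omit [DecidableEq G] in
/-- **Characterisation.**  If `φ ℓ` is the strict top POINT of the family and `ℓ` has least code among the letters naming that
point, then `ℓ` is the tie-broken top letter. [folklore] -/
theorem topLetter_eq_of_isStrictTop {w : Fin 2 → ℝ} {φ : G → (Fin 2 → ℝ)} {ℓ : G}
    (htop : IsStrictTop w (univ.image φ) (φ ℓ)) (hmin : ∀ ℓ', φ ℓ' = φ ℓ → enc ℓ ≤ enc ℓ') : topLetter w φ = ℓ := by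
  classical
  obtain ⟨h1, h2⟩ := topLetter_spec w φ
  set t := topLetter w φ
  have hmaxℓ : ∀ ℓ'', w ⬝ᵥ φ ℓ'' ≤ w ⬝ᵥ φ ℓ := fun ℓ'' => htop.le (mem_image_of_mem φ (mem_univ ℓ''))
  have hpt : φ t = φ ℓ := by
    by_contra hne
    have := htop.lt (mem_image_of_mem φ (mem_univ t)) hne
    exact absurd (h1 ℓ) (not_le.2 this)
  exact enc_injective (le_antisymm (h2 ℓ hmaxℓ) (hmin t hpt))

omit [DecidableEq G] in
/-- Letters naming the same point as the top letter have larger code. [folklore] -/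
theorem enc_topLetter_le {w : Fin 2 → ℝ} {φ : G → (Fin 2 → ℝ)} {ℓ' : G} (h : φ ℓ' = φ (topLetter w φ)) :
    enc (topLetter w φ) ≤ enc ℓ' :=
  (topLetter_spec w φ).2 ℓ' fun ℓ'' => by rw [h]; exact (topLetter_spec w φ).1 ℓ''

omit [DecidableEq G] in
/-- At a weight that separates the points of the family, the top letter names the strict top point. [folklore] -/
theorem isStrictTop_topLetter {w : Fin 2 → ℝ} {φ : G → (Fin 2 → ℝ)}
    (hinj : Set.InjOn (fun y => w ⬝ᵥ y) (univ.image φ : Finset (Fin 2 → ℝ))) :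
    IsStrictTop w (univ.image φ) (φ (topLetter w φ)) := by
  classical
  refine ⟨mem_image_of_mem φ (mem_univ _), fun y hy hne => lt_of_le_of_ne ?_ fun heq => hne ?_⟩
  · obtain ⟨ℓ', -, rfl⟩ := mem_image.1 hy
    exact (topLetter_spec w φ).1 ℓ'
  · exact hinj (mem_coe.2 hy) (mem_coe.2 (mem_image_of_mem φ (mem_univ _))) heq

/-! ### Generic times -/

section Geometry

variable (a b c : G → (Fin 2 → ℝ)) (σ : ℝ)

/-- All pair sums of the three pair systems (every pair fibre is a subset). -/
noncomputable def pairSums : Finset (Fin 2 → ℝ) :=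
  (univ.image fun p : G × G => a p.1 + b p.2) ∪ (univ.image fun p : G × G => b p.1 + c p.2) ∪
    (univ.image fun p : G × G => a p.1 + c p.2)

/-- The tie times along the half-chart `σ` of all pairs of pair sums: off this finite set the weight `(σ, t)` separates the
points of every pair fibre. -/
noncomputable def tieSet : Finset ℝ :=
  ((pairSums a b c ×ˢ pairSums a b c).filter fun p => p.1 1 ≠ p.2 1).image
    fun p => -(σ * (p.1 0 - p.2 0)) / (p.1 1 - p.2 1)

variable {a b c σ}

omit [AddCommGroup G] [DecidableEq G] in
/-- Off the tie set, `(σ, t)` (`σ ≠ 0`) is injective on every subset of the pair sums. [folklore] -/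
theorem injOn_of_not_mem_tieSet (hσ : σ ≠ 0) {t : ℝ} (ht : t ∉ tieSet a b c σ) {F : Finset (Fin 2 → ℝ)}
    (hF : F ⊆ pairSums a b c) : Set.InjOn (fun y => ![σ, t] ⬝ᵥ y) (F : Set (Fin 2 → ℝ)) := by
  classical
  intro y hy y' hy' heq
  simp only [chart_dotProduct] at heq
  by_contra hne
  by_cases h1 : y 1 = y' 1
  · have h0 : y 0 = y' 0 := by
      have : σ * (y 0 - y' 0) = 0 := by rw [h1] at heq; linarith
      rcases mul_eq_zero.1 this with h | h
      · exact absurd h hσ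
      · linarith
    exact hne (by ext i; fin_cases i <;> assumption)
  · apply ht
    unfold tieSet
    refine mem_image.2 ⟨(y, y'), mem_filter.2 ⟨mem_product.2 ⟨hF (mem_coe.1 hy), hF (mem_coe.1 hy')⟩, h1⟩, ?_⟩
    have h1' : y 1 - y' 1 ≠ 0 := sub_ne_zero.2 h1
    field_simp
    linarith

omit [DecidableEq G] in
/-- The `P`-fibre `r` lies in the pair sums. [folklore] -/
theorem fibreP_subset (r : G) : (univ.image fun x : G => a x + b (r - x)) ⊆ pairSums a b c := by
  intro p hp
  obtain ⟨x, -, rfl⟩ := mem_image.1 hp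
  unfold pairSums
  exact mem_union_left _ (mem_union_left _ (mem_image.2 ⟨(x, r - x), mem_univ _, rfl⟩))

omit [DecidableEq G] in
/-- The `Q`-fibre `t` lies in the pair sums. [folklore] -/
theorem fibreQ_subset (t : G) : (univ.image fun y : G => b y + c (t - y)) ⊆ pairSums a b c := by
  intro p hp
  obtain ⟨y, -, rfl⟩ := mem_image.1 hp
  unfold pairSums
  exact mem_union_left _ (mem_union_right _ (mem_image.2 ⟨(y, t - y), mem_univ _, rfl⟩))

omit [DecidableEq G] in
/-- The `R`-fibre `u` lies in the pair sums. [folklore] -/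
theorem fibreR_subset (u : G) : (univ.image fun x : G => a x + c (u - x)) ⊆ pairSums a b c := by
  intro p hp
  obtain ⟨x, -, rfl⟩ := mem_image.1 hp
  unfold pairSums
  exact mem_union_right _ (mem_image.2 ⟨(x, u - x), mem_univ _, rfl⟩)

omit [AddCommGroup G] [DecidableEq G] in
/-- **Generic exposing times.**  A chart top of any finite set is exposed at some time off the (finite) tie set. [folklore] -/
theorem exists_generic_exposing {F : Finset (Fin 2 → ℝ)} {v : Fin 2 → ℝ} {t₀ : ℝ} (h : IsStrictTop ![σ, t₀] F v) :
    ∃ t, IsStrictTop ![σ, t] F v ∧ t ∉ tieSet a b c σ := by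
  obtain ⟨ε, hε, hpert⟩ := h.exists_perturb_chart
  have hinf : (Set.Ioo (t₀ - ε) (t₀ + ε) \ (tieSet a b c σ : Set ℝ)).Infinite :=
    (Set.Ioo_infinite (by linarith)).sdiff (tieSet a b c σ).finite_toSet
  obtain ⟨t, ht, htZ⟩ := hinf.nonempty
  refine ⟨t, hpert t ?_, fun h => htZ (mem_coe.2 h)⟩
  rw [abs_le]; constructor <;> linarith [ht.1, ht.2]

/-! ### The sample set and its increasing enumeration -/

variable (a b c σ)

open Classical in
/-- A chosen generic exposing time of `v` as a chart top of class `s` (junk `0` if `v` is not a chart top). -/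
noncomputable def texp (s : G) (v : Fin 2 → ℝ) : ℝ :=
  if h : ∃ t, IsStrictTop ![σ, t] (univ.image fun p : G × G => a p.1 + b p.2 + c (s - p.1 - p.2)) v ∧ t ∉ tieSet a b c σ
  then Classical.choose h else 0

open Classical in
/-- The SAMPLE SET: one generic dummy time and the chosen exposing times of all chart tops of all classes. -/
noncomputable def samples : Finset ℝ :=
  insert (Classical.choose (Infinite.exists_notMem_finset (tieSet a b c σ)))
    (univ.biUnion fun s : G => ((univ.image fun p : G × G => a p.1 + b p.2 + c (s - p.1 - p.2)).filter fun v =>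
      ∃ t, IsStrictTop ![σ, t] (univ.image fun p : G × G => a p.1 + b p.2 + c (s - p.1 - p.2)) v).image (texp a b c σ s))

/-- The number of sample STEPS (`#samples - 1`). -/
noncomputable def Nσ : ℕ := (samples a b c σ).card - 1

/-- The increasing enumeration of the samples, `τ 0 ≤ τ 1 ≤ ⋯ ≤ τ N` (constant after `N`). -/
noncomputable def tau (i : ℕ) : ℝ :=
  (samples a b c σ).orderEmbOfFin rfl
    ⟨min i (Nσ a b c σ), by
      have : 0 < (samples a b c σ).card := by unfold samples; exact card_pos.2 (insert_nonempty _ _)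
      unfold Nσ; omega⟩

variable {a b c σ}

omit [DecidableEq G] in
/-- `tau` is monotone. [folklore] -/
theorem tau_mono {i j : ℕ} (h : i ≤ j) : tau a b c σ i ≤ tau a b c σ j := by
  unfold tau
  exact (OrderEmbedding.le_iff_le _).2 (by simp only [Fin.mk_le_mk]; exact min_le_min_right _ h)

omit [DecidableEq G] in
/-- Every sample is `tau i` for some `i ≤ N`. [folklore] -/
theorem exists_tau_eq {t : ℝ} (ht : t ∈ samples a b c σ) : ∃ i ≤ Nσ a b c σ, tau a b c σ i = t := by
  have hrange := range_orderEmbOfFin (samples a b c σ) rfl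
  have ht' : t ∈ Set.range ((samples a b c σ).orderEmbOfFin rfl) := by rw [hrange]; exact mem_coe.2 ht
  obtain ⟨k, hk⟩ := ht'
  have hpos : 0 < (samples a b c σ).card := card_pos.2 ⟨t, ht⟩
  refine ⟨k.val, by unfold Nσ; omega, ?_⟩
  unfold tau
  rw [← hk]
  congr 1
  ext
  simp only
  have := k.isLt
  unfold Nσ
  omega

omit [DecidableEq G] in
/-- Every sample time is generic. [folklore] -/
theorem tau_not_mem_tieSet (i : ℕ) : tau a b c σ i ∉ tieSet a b c σ := by
  classical
  have hmem : tau a b c σ i ∈ samples a b c σ := by unfold tau; exact orderEmbOfFin_mem _ _ _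
  unfold samples at hmem
  rcases mem_insert.1 hmem with h | h
  · rw [h]; exact Classical.choose_spec (Infinite.exists_notMem_finset (tieSet a b c σ))
  · obtain ⟨s, -, hs⟩ := mem_biUnion.1 h
    obtain ⟨v, hv, hsv⟩ := mem_image.1 hs
    obtain ⟨-, t₀, ht₀⟩ := mem_filter.1 hv
    have hex := exists_generic_exposing (a := a) (b := b) (c := c) ht₀
    rw [← hsv]
    unfold texp
    rw [dif_pos hex]
    exact (Classical.choose_spec hex).2

omit [DecidableEq G] in
/-- A chart top of class `s` is the strict top at its chosen time, which is a sample. [folklore] -/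
theorem isStrictTop_texp {s : G} {v : Fin 2 → ℝ} {t₀ : ℝ}
    (h : IsStrictTop ![σ, t₀] (univ.image fun p : G × G => a p.1 + b p.2 + c (s - p.1 - p.2)) v) :
    IsStrictTop ![σ, texp a b c σ s v] (univ.image fun p : G × G => a p.1 + b p.2 + c (s - p.1 - p.2)) v ∧
      texp a b c σ s v ∈ samples a b c σ := by
  classical
  have hex := exists_generic_exposing (a := a) (b := b) (c := c) h
  constructor
  · unfold texp; rw [dif_pos hex]; exact (Classical.choose_spec hex).1
  · unfold samples
    refine mem_insert_of_mem (mem_biUnion.2 ⟨s, mem_univ _, mem_image.2 ⟨v, mem_filter.2 ⟨h.mem, t₀, h⟩, rfl⟩⟩)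

/-! ### The three top systems along the samples are interval systems -/

variable (a b c σ)

/-- Top letter of the `P`-fibre `r` at sample `i` (the `x` of the top pair `(x, r - x)`). -/
noncomputable def TPs (i : ℕ) (r : G) : G := topLetter ![σ, tau a b c σ i] fun x => a x + b (r - x)

/-- Top letter of the `Q`-fibre `t` at sample `i` (the `y` of the top pair `(y, t - y)`). -/
noncomputable def TQs (i : ℕ) (t : G) : G := topLetter ![σ, tau a b c σ i] fun y => b y + c (t - y)

/-- Top letter of the `R`-fibre `u` at sample `i` (the `x` of the top pair `(x, u - x)`). -/
noncomputable def TRs (i : ℕ) (u : G) : G := topLetter ![σ, tau a b c σ i] fun x => a x + c (u - x)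

variable {a b c σ}

omit [DecidableEq G] in
/-- **Interval property of tie-broken tops along a chart.**  For a letter-indexed family depending on the fibre, if the sample
weights separate its points then the top letters along the samples form an interval system. [folklore] -/
theorem isIntervalSys_topLetter (hσ : σ ≠ 0) (φ : G → G → (Fin 2 → ℝ))
    (hφ : ∀ f, (univ.image (φ f)) ⊆ pairSums a b c) (N : ℕ) :
    IsIntervalSys N (fun i f => topLetter ![σ, tau a b c σ i] (φ f)) := by
  intro f ℓ i j k hij hjk _ hi hk
  have gi := isStrictTop_topLetter (injOn_of_not_mem_tieSet hσ (tau_not_mem_tieSet i) (hφ f)) (φ := φ f)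
  have gk := isStrictTop_topLetter (injOn_of_not_mem_tieSet hσ (tau_not_mem_tieSet k) (hφ f)) (φ := φ f)
  simp only at hi hk
  rw [hi] at gi
  rw [hk] at gk
  have gj := gi.of_between gk (tau_mono hij) (tau_mono hjk)
  refine topLetter_eq_of_isStrictTop gj fun ℓ' hℓ' => ?_
  have := enc_topLetter_le (w := ![σ, tau a b c σ i]) (φ := φ f) (ℓ' := ℓ') (by rw [hℓ', hi])
  rwa [hi] at this

omit [DecidableEq G] in
/-- The `P`-tops along the samples form an interval system. [folklore] -/
theorem isIntervalSys_TPs (hσ : σ ≠ 0) (N : ℕ) : IsIntervalSys N (TPs a b c σ) :=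
  isIntervalSys_topLetter hσ (fun r x => a x + b (r - x)) (fun r => fibreP_subset r) N

omit [DecidableEq G] in
/-- The `Q`-tops along the samples form an interval system. [folklore] -/
theorem isIntervalSys_TQs (hσ : σ ≠ 0) (N : ℕ) : IsIntervalSys N (TQs a b c σ) :=
  isIntervalSys_topLetter hσ (fun t y => b y + c (t - y)) (fun t => fibreQ_subset t) N

omit [DecidableEq G] in
/-- The `R`-tops along the samples form an interval system. [folklore] -/
theorem isIntervalSys_TRs (hσ : σ ≠ 0) (N : ℕ) : IsIntervalSys N (TRs a b c σ) :=
  isIntervalSys_topLetter hσ (fun u x => a x + c (u - x)) (fun u => fibreR_subset u) N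

end Geometry

end TotalsLaw

end Summit.ValiantsHypothesis.ValiantsHypothesis.Theorems.NewtonUnitEquationsDissociatedUniform
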